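import Summits.Schanuel.Schanuel.Theorems.ZilberEacInvariantDirectionExistence
import Literature.ModelTheory.Zilber.EACDensityQuestion
import HarnessLib

/-!
# Bases EQUIVARIANT under a lattice direction: existence in the slow regime

Zilber's Exponential-Algebraic Closedness, case ladder (host summit Schanuel, cell `pub-schanuel`,
seat 2, gen 12).  `ZilberEacInvariantDirectionExistence` treats bases INVARIANT under a lattice
direction `q` (`g(x + zq) = g(x)`): along the shifted rays the coupling `e^{g}` stays bounded.  Here
the base is only EQUIVARIANT: `g(x + zq) = g(x) + βz` for a real `β` — every real hyperplane
`Σ rᵢxᵢ + c` (with `β = Σ rᵢqᵢ`, for EVERY `q`) and, in degree `≥ 2`, e.g. `x₂ = -(x₀ - x₁)² + βx₀` with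
`q = (1,1)` (O53 (b): "degenerate balance directions over NON-invariant bases").  Along the labelled
moving lattice centres `c(m) = (2πi m + λ log m) q + (2πi p + log a + o(1))` (degrees `dⱼ = λqⱼ`)

  `g(c(m) + ξ) = g(2πi p + log a + o(1) + ξ) + β(2πi m + λ log m)`,

so `|e^{g}| ≍ m^{βλ}` on the unit polydiscs (a ROTATING power coordinate of polynomial size): the
coupling `e^{g} fⱼ(e^{g})` is relatively small in the slow regime `βλ + max(βλ,0) deg fⱼ < dⱼ`, and the
moving-polydisc contraction (`exists_exp_eq_poly_add_near_centre`) applies.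

* `eventually_perturbation_le_of_exp_bound` — the slow-regime smallness from a bound
  `|e^{E}| ≤ e^{C₀} m^{κ}` on the unit polydiscs (`κ + max(κ,0) deg f < d`);
* **`exists_solutions_equivariantDirection`** — for every label `p` solutions
  `x(m) = r(m) + (2πi m + λ log m) q` with `r(m) → 2πi p + log a` and
  `g(x(m)) = g(r(m)) + β(2πi m + λ log m)` — the input of THEOREM M (`ZilberEacRotatingPower`);
  density: `ZilberEacEquivariantDirectionDensity`.

HONEST FRAMING: an existence theorem for explicit families inside an OPEN cell; `EC(3,2)` OPEN;
NOT Schanuel's conjecture; EAC ⇏ SC.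
-/

noncomputable section

open Complex MvPolynomial Metric Set Filter Topology
open Literature.NumberTheory.Transcendental Literature.ModelTheory.Zilber

set_option linter.dupNamespace false

namespace Summit.Schanuel.Schanuel.Theorems

section Equivariant

variable {s : ℕ}

/-- **Slow-regime smallness.**  If `|e^{E_m(c(m) + ξ)}| ≤ e^{C₀} m^{κ}` on the closed unit polydiscs
(large `m`) and `κ + max(κ,0) deg f < d`, then for every `θ > 0` eventually
`‖e^{E} f(e^{E})‖ ≤ θ m^{d}` on the open unit polydiscs. [folklore] -/
theorem eventually_perturbation_le_of_exp_bound (f : Polynomial ℂ) {κ C₀ : ℝ} {d : ℕ}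
    (hslow : κ + max κ 0 * (f.natDegree : ℝ) < d) (E : ℕ → (Fin s → ℂ) → ℂ) (c : ℕ → Fin s → ℂ)
    (hE : ∀ᶠ m : ℕ in atTop, ∀ ξ : Fin s → ℂ, ‖ξ‖ ≤ 1 →
      ‖exp (E m (c m + ξ))‖ ≤ Real.exp C₀ * (m : ℝ) ^ κ) :
    ∀ θ : ℝ, 0 < θ → ∀ᶠ m : ℕ in atTop, ∀ ξ : Fin s → ℂ, ‖ξ‖ < 1 →
      ‖exp (E m (c m + ξ)) * f.eval (exp (E m (c m + ξ)))‖ ≤ θ * (m : ℝ) ^ d := by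
  intro θ hθ
  set B : ℝ := ∑ i ∈ Finset.range (f.natDegree + 1), ‖f.coeff i‖ with hB
  have hB0 : 0 ≤ B := Finset.sum_nonneg fun i _ => norm_nonneg _
  set μ : ℝ := κ + max κ 0 * (f.natDegree : ℝ) with hμ
  set Kc : ℝ := Real.exp C₀ * (B * Real.exp |C₀| ^ f.natDegree) with hKc
  have hK0 : 0 ≤ Kc := by positivity
  have hbound : ∀ᶠ m : ℕ in atTop, ∀ ξ : Fin s → ℂ, ‖ξ‖ ≤ 1 →
      ‖exp (E m (c m + ξ)) * f.eval (exp (E m (c m + ξ)))‖ ≤ Kc * (m : ℝ) ^ μ := by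
    filter_upwards [hE, eventually_ge_atTop 1] with m hm hm_one ξ hξ
    have hm1' : (1 : ℝ) ≤ m := by exact_mod_cast hm_one
    have hm0 : (0 : ℝ) < m := by linarith
    have hexp := hm ξ hξ
    have hmax : max 1 ‖exp (E m (c m + ξ))‖ ≤ Real.exp |C₀| * (m : ℝ) ^ max κ 0 := by
      have h1 : (1 : ℝ) ≤ Real.exp |C₀| * (m : ℝ) ^ max κ 0 := by
        have ha' : (1 : ℝ) ≤ Real.exp |C₀| := Real.one_le_exp (abs_nonneg _)
        have hb : (1 : ℝ) ≤ (m : ℝ) ^ max κ 0 := Real.one_le_rpow hm1' (le_max_right _ _)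
        nlinarith
      have h2 : Real.exp C₀ * (m : ℝ) ^ κ ≤ Real.exp |C₀| * (m : ℝ) ^ max κ 0 :=
        mul_le_mul (Real.exp_le_exp.2 (le_abs_self _))
          (Real.rpow_le_rpow_of_exponent_le hm1' (le_max_left _ _))
          (Real.rpow_nonneg hm0.le _) (Real.exp_pos _).le
      exact max_le h1 (hexp.trans h2)
    have hF : ‖f.eval (exp (E m (c m + ξ)))‖ ≤ B * (Real.exp |C₀| * (m : ℝ) ^ max κ 0) ^ f.natDegree :=
      (norm_eval_le_sum_mul_pow f _).trans
        (mul_le_mul_of_nonneg_left (pow_le_pow_left₀ (zero_le_one.trans (le_max_left _ _)) hmax _)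
          hB0)
    calc ‖exp (E m (c m + ξ)) * f.eval (exp (E m (c m + ξ)))‖
        = ‖exp (E m (c m + ξ))‖ * ‖f.eval (exp (E m (c m + ξ)))‖ := norm_mul _ _
      _ ≤ (Real.exp C₀ * (m : ℝ) ^ κ) * (B * (Real.exp |C₀| * (m : ℝ) ^ max κ 0) ^ f.natDegree) :=
          mul_le_mul hexp hF (norm_nonneg _) (by positivity)
      _ = Kc * ((m : ℝ) ^ κ * ((m : ℝ) ^ max κ 0) ^ f.natDegree) := by rw [hKc, mul_pow]; ring
      _ = Kc * (m : ℝ) ^ μ := by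
          rw [hμ, ← Real.rpow_natCast, ← Real.rpow_mul hm0.le, Real.rpow_add hm0]
  have hev : ∀ᶠ m : ℕ in atTop, Kc * (m : ℝ) ^ μ ≤ θ * (m : ℝ) ^ (d : ℝ) := by
    have hgap : 0 < (d : ℝ) - μ := by rw [hμ]; linarith
    have h1 : Tendsto (fun m : ℕ => (m : ℝ) ^ ((d : ℝ) - μ)) atTop atTop :=
      (tendsto_rpow_atTop hgap).comp tendsto_natCast_atTop_atTop
    filter_upwards [h1.eventually_ge_atTop (Kc / θ), eventually_ge_atTop 1] with m hm hm_one
    have hm0 : (0 : ℝ) < m := by exact_mod_cast hm_one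
    have h2 : Kc ≤ θ * (m : ℝ) ^ ((d : ℝ) - μ) := by
      rw [div_le_iff₀ hθ] at hm
      linarith [hm]
    calc Kc * (m : ℝ) ^ μ ≤ θ * (m : ℝ) ^ ((d : ℝ) - μ) * (m : ℝ) ^ μ :=
          mul_le_mul_of_nonneg_right h2 (Real.rpow_nonneg hm0.le _)
      _ = θ * (m : ℝ) ^ (d : ℝ) := by rw [mul_assoc, ← Real.rpow_add hm0, sub_add_cancel]
  filter_upwards [hbound, hev] with m hm hmθ ξ hξ
  have h := hm ξ hξ.le
  rw [← Real.rpow_natCast]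
  exact h.trans hmθ

/-- **THEOREM (existence over an equivariant base, slow regime).**  `g(x + zq) = g(x) + βz` (`β` real),
leading forms `(Aⱼ)_{dⱼ}(2πiq) ≠ 0`, degrees `dⱼ = λqⱼ`, fibre polynomials `fⱼ ∈ ℂ[u]` with
`βλ + max(βλ,0) deg fⱼ < dⱼ`: for every label `p ∈ ℤˢ` there are solutions
`x(m) = r(m) + (2πi m + λ log m) q` of `e^{xⱼ} = Aⱼ(x) + e^{g(x)} fⱼ(e^{g(x)})` (large `m`) with
`r(m) → 2πi p + log a` and `g(x(m)) = g(r(m)) + β(2πi m + λ log m)`. (new)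
[cite: MantovaMasser2023, §1 p.5 (the open case dim π(V) = 2 in ℂ³×ℂˣ³)] -/
theorem exists_solutions_equivariantDirection (g : MvPolynomial (Fin s) ℂ) (q : Fin s → ℤ) (β : ℝ)
    (hequiv : ∀ (x : Fin s → ℂ) (z : ℂ),
      eval (x + z • fun j => (q j : ℂ)) g = eval x g + (β : ℂ) * z)
    (A : Fin s → MvPolynomial (Fin s) ℂ)
    (hA : ∀ j, eval (fun i => 2 * Real.pi * I * (q i : ℂ))
      (homogeneousComponent (A j).totalDegree (A j)) ≠ 0)
    (lam : ℝ) (hlam : ∀ j, ((A j).totalDegree : ℝ) = lam * (q j : ℝ)) (f : Fin s → Polynomial ℂ)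
    (hslow : ∀ j, β * lam + max (β * lam) 0 * ((f j).natDegree : ℝ) < (A j).totalDegree)
    (p : Fin s → ℤ) :
    ∃ (x r : ℕ → Fin s → ℂ),
      (∀ᶠ m : ℕ in atTop, ∀ j, exp (x m j) =
        eval (x m) (A j) + exp (eval (x m) g) * (f j).eval (exp (eval (x m) g))) ∧
      (∀ m, x m = r m + (2 * Real.pi * I * (m : ℂ) + (lam : ℂ) * log (m : ℂ)) •
        fun j => (q j : ℂ)) ∧
      (∀ m, eval (x m) g = eval (r m) g +
        (β : ℂ) * (2 * Real.pi * I * (m : ℂ) + (lam : ℂ) * log (m : ℂ))) ∧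
      Tendsto r atTop (𝓝 fun j => 2 * Real.pi * I * (p j : ℂ) +
        log (eval (fun i => 2 * Real.pi * I * (q i : ℂ))
          (homogeneousComponent (A j).totalDegree (A j)))) := by
  classical
  -- data: leading values `a`, the ratios `Aⱼ(m v)/(m^{dⱼ} aⱼ) → 1`
  obtain ⟨a, ha⟩ : ∃ a : Fin s → ℂ, a = fun j => eval (fun i => 2 * Real.pi * I * (q i : ℂ))
    (homogeneousComponent (A j).totalDegree (A j)) := ⟨_, rfl⟩
  have ha0 : ∀ j, a j ≠ 0 := fun j => by rw [ha]; exact hA j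
  have hdC : ∀ j, (((A j).totalDegree : ℕ) : ℂ) = (lam : ℂ) * (q j : ℂ) := by
    intro j
    have h := congrArg (fun r : ℝ => (r : ℂ)) (hlam j)
    push_cast at h
    exact h
  obtain ⟨ratio, hratio⟩ : ∃ ratio : Fin s → ℕ → ℂ, ratio = fun j (m : ℕ) =>
    eval (fun i => (m : ℂ) * (2 * Real.pi * I * (q i : ℂ))) (A j) /
      ((m : ℂ) ^ (A j).totalDegree * a j) := ⟨_, rfl⟩
  have hratio1 : ∀ j, Tendsto (ratio j) atTop (𝓝 1) := by
    intro j
    rw [hratio, ha]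
    exact tendsto_latticeValue_div (A j) _ (hA j)
  have hlogratio : ∀ j, Tendsto (fun m => log (ratio j m)) atTop (𝓝 0) := by
    intro j
    have h := (hratio1 j).clog Complex.one_mem_slitPlane
    rwa [Complex.log_one] at h
  have hratio_ne : ∀ᶠ m : ℕ in atTop, ∀ j, ratio j m ≠ 0 :=
    eventually_all.2 fun j => (hratio1 j).eventually (isOpen_ne.mem_nhds one_ne_zero)
  -- the logarithm branch, the escape parameter `y(m)`, the transversal part `rc(m)`, the centres
  obtain ⟨lb, hlb⟩ : ∃ lb : ℕ → Fin s → ℂ, lb = fun (m : ℕ) j =>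
    (((A j).totalDegree : ℕ) : ℂ) * log (m : ℂ) + log (a j) + log (ratio j m) := ⟨_, rfl⟩
  obtain ⟨y, hy⟩ : ∃ y : ℕ → ℂ,
    y = fun (m : ℕ) => 2 * Real.pi * I * (m : ℂ) + (lam : ℂ) * log (m : ℂ) := ⟨_, rfl⟩
  obtain ⟨rc, hrc⟩ : ∃ rc : ℕ → Fin s → ℂ,
    rc = fun (m : ℕ) j => 2 * Real.pi * I * (p j : ℂ) + log (a j) + log (ratio j m) := ⟨_, rfl⟩
  obtain ⟨c, hc⟩ : ∃ c : ℕ → Fin s → ℂ, c = fun m => rc m + y m • fun j => (q j : ℂ) := ⟨_, rfl⟩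
  have hc' : ∀ m j, c m j = (m : ℂ) * (2 * Real.pi * I * (q j : ℂ)) +
      (2 * Real.pi * I * (p j : ℂ) + lb m j) := by
    intro m j
    simp only [hc, hrc, hy, hlb, Pi.add_apply, Pi.smul_apply, smul_eq_mul]
    rw [hdC j]
    ring
  -- the transversal part of the centres converges and is eventually bounded
  have hrc_lim : Tendsto rc atTop (𝓝 fun j => 2 * Real.pi * I * (p j : ℂ) + log (a j)) := by
    rw [hrc]
    refine tendsto_pi_nhds.2 fun j => ?_
    have h := (hlogratio j).const_add (2 * Real.pi * I * (p j : ℂ) + log (a j))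
    rwa [add_zero] at h
  have hrc_bdd : ∀ᶠ m : ℕ in atTop,
      ‖rc m‖ ≤ ‖fun j => 2 * Real.pi * I * (p j : ℂ) + log (a j)‖ + 1 := by
    have h := hrc_lim
    rw [tendsto_iff_norm_sub_tendsto_zero] at h
    filter_upwards [h.eventually (gt_mem_nhds zero_lt_one)] with m hm
    have := norm_le_norm_add_norm_sub' (rc m) (fun j => 2 * Real.pi * I * (p j : ℂ) + log (a j))
    linarith [hm.le]
  -- (C1) `exp c(m)ⱼ = Aⱼ(m v)` eventually
  have hcexp : ∀ᶠ m : ℕ in atTop, ∀ j,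
      exp (c m j) = eval (fun k => (m : ℂ) * (2 * Real.pi * I * (q k : ℂ))) (A j) := by
    filter_upwards [hratio_ne, eventually_ge_atTop 1] with m hm hm1 j
    have hmC : (m : ℂ) ≠ 0 := by exact_mod_cast (show m ≠ 0 by omega)
    rw [hc', Complex.exp_add, exp_natCast_mul_twoPiI_mul_intCast, one_mul, Complex.exp_add,
      exp_two_pi_I_mul_intCast, one_mul, hlb]
    dsimp only
    rw [Complex.exp_add, Complex.exp_add, Complex.exp_log (ha0 j), Complex.exp_log (hm j),
      Complex.exp_nat_mul, Complex.exp_log hmC, hratio]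
    dsimp only
    have hden : (m : ℂ) ^ (A j).totalDegree * a j ≠ 0 := mul_ne_zero (pow_ne_zero _ hmC) (ha0 j)
    rw [mul_div_assoc', mul_comm ((m : ℂ) ^ (A j).totalDegree * a j), mul_div_assoc,
      div_self hden, mul_one]
  -- (C2) `‖c(m) - m v‖ = O(log m)`
  have hcsmall : ∀ δ : ℝ, 0 < δ → ∀ᶠ m : ℕ in atTop,
      ‖c m - fun i => (m : ℂ) * (2 * Real.pi * I * (q i : ℂ))‖ + 1 ≤ δ * m := by
    intro δ hδ
    set K : ℝ := ∑ j, (‖(2 * Real.pi * I * (p j : ℂ) : ℂ)‖ + ‖log (a j)‖) + 2 with hK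
    set D : ℝ := ∑ j, ((A j).totalDegree : ℝ) with hD
    have hlog1 : ∀ j, ∀ᶠ m : ℕ in atTop, ‖log (ratio j m)‖ ≤ 1 := by
      intro j
      have h := (hlogratio j)
      rw [tendsto_zero_iff_norm_tendsto_zero] at h
      filter_upwards [h.eventually (gt_mem_nhds zero_lt_one)] with m hm
      exact hm.le
    filter_upwards [eventually_all.2 hlog1, eventually_mul_log_add_le D K hδ, eventually_ge_atTop 1]
      with m hm hmδ hm1
    have hlogm : 0 ≤ Real.log m := Real.log_nonneg (by exact_mod_cast hm1)
    have hnlog : ‖log (m : ℂ)‖ = Real.log m := by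
      rw [← Complex.natCast_log, Complex.norm_real, Real.norm_eq_abs, abs_of_nonneg hlogm]
    have hcomp : ∀ j, ‖(c m - fun i => (m : ℂ) * (2 * Real.pi * I * (q i : ℂ))) j‖ ≤
        D * Real.log m + (K - 1) := by
      intro j
      have e : (c m - fun i => (m : ℂ) * (2 * Real.pi * I * (q i : ℂ))) j =
          2 * Real.pi * I * (p j : ℂ) + lb m j := by
        rw [Pi.sub_apply, hc']; ring
      rw [e, hlb]
      dsimp only
      have hdj : ((A j).totalDegree : ℝ) ≤ D :=
        Finset.single_le_sum (f := fun j => ((A j).totalDegree : ℝ)) (fun _ _ => by positivity)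
          (Finset.mem_univ j)
      have hKj : ‖(2 * Real.pi * I * (p j : ℂ) : ℂ)‖ + ‖log (a j)‖ ≤ K - 2 := by
        have := Finset.single_le_sum
          (f := fun j => ‖(2 * Real.pi * I * (p j : ℂ) : ℂ)‖ + ‖log (a j)‖)
          (fun _ _ => by positivity) (Finset.mem_univ j)
        rw [hK]; linarith
      have hn1 : ‖(((A j).totalDegree : ℕ) : ℂ) * log (m : ℂ)‖ = (A j).totalDegree * Real.log m := by
        rw [norm_mul, Complex.norm_natCast, hnlog]
      have h3 := norm_add₃_le (a := (((A j).totalDegree : ℕ) : ℂ) * log (m : ℂ)) (b := log (a j))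
        (c := log (ratio j m))
      calc ‖2 * Real.pi * I * (p j : ℂ) +
            ((((A j).totalDegree : ℕ) : ℂ) * log (m : ℂ) + log (a j) + log (ratio j m))‖
          ≤ ‖(2 * Real.pi * I * (p j : ℂ) : ℂ)‖ +
            ‖(((A j).totalDegree : ℕ) : ℂ) * log (m : ℂ) + log (a j) + log (ratio j m)‖ :=
            norm_add_le _ _
        _ ≤ ‖(2 * Real.pi * I * (p j : ℂ) : ℂ)‖ +
            (‖(((A j).totalDegree : ℕ) : ℂ) * log (m : ℂ)‖ + ‖log (a j)‖ + ‖log (ratio j m)‖) := by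
            linarith
        _ ≤ D * Real.log m + (K - 1) := by
            rw [hn1]
            nlinarith [hm j, hdj, hKj, hlogm]
    have hD0 : 0 ≤ D := by rw [hD]; exact Finset.sum_nonneg fun j _ => Nat.cast_nonneg _
    have hK2 : 2 ≤ K := by
      rw [hK]
      have := Finset.sum_nonneg fun j (_ : j ∈ (Finset.univ : Finset (Fin s))) =>
        (show 0 ≤ ‖(2 * Real.pi * I * (p j : ℂ) : ℂ)‖ + ‖log (a j)‖ by positivity)
      linarith
    have hnn : 0 ≤ D * Real.log m + (K - 1) := by
      have := mul_nonneg hD0 hlogm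
      linarith
    have hnorm : ‖c m - fun i => (m : ℂ) * (2 * Real.pi * I * (q i : ℂ))‖ ≤
        D * Real.log m + (K - 1) :=
      (pi_norm_le_iff_of_nonneg hnn).2 hcomp
    linarith
  -- the perturbation; equivariance `g(c(m) + ξ) = g(rc(m) + ξ) + β y(m)`
  obtain ⟨P, hP⟩ : ∃ P : ℕ → Fin s → (Fin s → ℂ) → ℂ,
    P = fun _ j x => exp (eval x g) * (f j).eval (exp (eval x g)) := ⟨_, rfl⟩
  have hPdiff : ∀ᶠ m : ℕ in atTop, ∀ j, DifferentiableOn ℂ (P m j) (ball (c m) 1) := by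
    filter_upwards with m j
    rw [hP]
    have h1 : Differentiable ℂ fun x : Fin s → ℂ => exp (eval x g) :=
      (differentiable_mvPolynomial_eval g).cexp
    exact (h1.mul ((f j).differentiable.comp h1)).differentiableOn
  have hshift : ∀ m ξ, eval (c m + ξ) g = eval (rc m + ξ) g + (β : ℂ) * y m := by
    intro m ξ
    rw [hc]
    dsimp only
    rw [show rc m + y m • (fun j => (q j : ℂ)) + ξ = (rc m + ξ) + y m • fun j => (q j : ℂ) by abel,
      hequiv]
  -- (C3) `|e^{β y(m)}| = m^{βλ}` and `|e^{g(rc(m) + ξ)}| ≤ e^{M}` on the unit polydiscs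
  have hnormexp : ∀ m : ℕ, 1 ≤ m → ‖exp ((β : ℂ) * y m)‖ = (m : ℝ) ^ (β * lam) := by
    intro m hm
    have hm0 : (0 : ℝ) < m := by exact_mod_cast hm
    rw [Complex.norm_exp, hy]
    dsimp only
    have hre : ((β : ℂ) * (2 * Real.pi * I * (m : ℂ) + (lam : ℂ) * log (m : ℂ))).re =
        β * lam * Real.log m := by
      rw [← Complex.natCast_log]
      simp only [Complex.mul_re, Complex.add_re, Complex.add_im, Complex.mul_im, Complex.ofReal_re,
        Complex.ofReal_im, Complex.I_re, Complex.I_im, Complex.re_ofNat, Complex.im_ofNat,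
        Complex.natCast_re, Complex.natCast_im, mul_zero, zero_mul, add_zero, sub_zero, mul_one,
        zero_add, sub_self]
      ring
    rw [hre, Real.rpow_def_of_pos hm0, mul_comm (Real.log m)]
  obtain ⟨Cg, hCg, Ng, hg⟩ :=
    Literature.NumberTheory.Transcendental.HypersurfaceCover.exists_norm_eval_le_pow g
  set R : ℝ := ‖fun j => 2 * Real.pi * I * (p j : ℂ) + log (a j)‖ + 1 with hR
  set M : ℝ := Cg * (1 + (R + 1)) ^ Ng with hM
  have hE : ∀ᶠ m : ℕ in atTop, ∀ ξ : Fin s → ℂ, ‖ξ‖ ≤ 1 →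
      ‖exp (eval (c m + ξ) g)‖ ≤ Real.exp M * (m : ℝ) ^ (β * lam) := by
    filter_upwards [hrc_bdd, eventually_ge_atTop 1] with m hm hm1 ξ hξ
    have hR0 : 0 ≤ R := by positivity
    have hz : ‖rc m + ξ‖ ≤ R + 1 := (norm_add_le _ _).trans (by linarith)
    have hgb : ‖eval (rc m + ξ) g‖ ≤ M := (hg _).trans (by
      rw [hM]
      exact mul_le_mul_of_nonneg_left (pow_le_pow_left₀ (by positivity) (by linarith) _) hCg)
    rw [hshift, Complex.exp_add, norm_mul, hnormexp m hm1]
    refine mul_le_mul_of_nonneg_right ?_ (Real.rpow_nonneg (Nat.cast_nonneg m) _)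
    rw [Complex.norm_exp]
    exact Real.exp_le_exp.2 ((Complex.re_le_norm _).trans hgb)
  have hPsmall : ∀ j, ∀ θ : ℝ, 0 < θ → ∀ᶠ m : ℕ in atTop, ∀ ξ : Fin s → ℂ, ‖ξ‖ < 1 →
      ‖P m j (c m + ξ)‖ ≤ θ * (m : ℝ) ^ (A j).totalDegree := by
    intro j θ hθ
    filter_upwards [eventually_perturbation_le_of_exp_bound (f j) (hslow j) (fun _ x => eval x g) c
      hE θ hθ] with m hm ξ hξ
    rw [hP]
    exact hm ξ hξ
  -- (C5) solutions near the centres, and a sequence with `x(m) - c(m) → 0`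
  have hsol : ∀ ε : ℝ, 0 < ε → ∀ᶠ m : ℕ in atTop, ∃ x ∈ {x : Fin s → ℂ |
      ∀ j, exp (x j) = eval x (A j) + P m j x}, ‖x - c m‖ ≤ ε := by
    intro ε hε
    filter_upwards [exists_exp_eq_poly_add_near_centre q A hA c hcexp hcsmall P hPdiff hPsmall hε]
      with m hm
    obtain ⟨x, hx, hsol⟩ := hm
    exact ⟨x, hsol, hx⟩
  obtain ⟨x, hxS, hxc⟩ := exists_seq_of_forall_eventually_exists_near _ c hsol
  refine ⟨x, fun m => x m - y m • fun j => (q j : ℂ), ?_, fun m => ?_, fun m => ?_, ?_⟩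
  · filter_upwards [hxS] with m hm j
    have h := hm j
    rw [hP] at h
    exact h
  · simp only [hy, sub_add_cancel]
  · have h := hequiv (x m - y m • fun j => (q j : ℂ)) (y m)
    rw [sub_add_cancel] at h
    rw [h, hy]
  · -- `r(m) = (x(m) - c(m)) + rc(m) → 0 + r_p`
    have he : (fun m => x m - y m • fun j => (q j : ℂ)) = fun m => (x m - c m) + rc m := by
      funext m; rw [hc]; dsimp only; abel
    rw [he]
    simp only [ha] at hrc_lim
    have h := hxc.add hrc_lim
    rw [zero_add] at h
    exact h

end Equivariant

end Summit.Schanuel.Schanuel.Theorems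

end
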